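import Summits.Ventures.HSemireg.WedgeWeilPurityLocus
import Summits.Ventures.HSemireg.WedgeBoxPatternRank

/-!
# Venture HSemireg — the purity-degree rows without a locus: rank-one h-part, one-sided class, pure Weil pair

HONEST FRAMING. Part of the Lean index of the computation cell `pub-hsemireg` (second enclosure wave, cut by seat p6 in the
conventions of seat p3's ENCLOSURE-PLAN-p3.md / build.py from th-7's kernel assets).  Finite-dimensional exterior algebra over a field ONLY:
no variety, no cohomology theory, no semiregularity map is constructed here; nothing here says that HC / HC_CM / HC_AV holds;
no Literature fact is declared or used.  The geometric DICTIONARY (why these ranks are the `HT`-side box ranks of the cell's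
STRUCTURE.md §1 / theory/FORMULA-N.md) lives in theory/FORMULA-N-th7.md PART B §A.3 / §N and is NOT asserted in Lean.

th-7's PART W2 + W3 — TRANSPORT OF PART G through PART W's change of generators `Φ` (theory/th7/WeilPurity.lean v6 sha256/16 32700a71e785aa92 (th-7 g6, 23:55Z 2026-08-22; = v5 4d7ab5385cc785fa + PART G two-zero corollaries + PART W3 (= v5.1 f732a146a33beda5) + PART R4; ×2 farm + negative controls + numerics at p6 g7), from the `PART W2`
header to the end of the file), VERBATIM up to namespaces (as in the other `WedgeWeilPurity*.lean` files): at the middle degree `m = n` of the `(n,n)` Weil model,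
every field, every `n ≥ 1` — **`weilPurity_rankOne`** / **`weilRankOne_vW`** (rank-ONE h-part `c₁·Π(x_c + λy_c)`, both Weil vectors, `c₁ab ≠ 0`:
`rank + 2 = 3·C(2n,n)`, NO exceptional locus = W-PURITY(1)), **`weilPurity_oneSided`** / `weilPurity_oneSided'` / **`weilOneSided_vW`** (two-exponential h-part,
ONE Weil vector: `rank + 2 = 3·C(2n,n)`, NO locus — the degree between `weilRank_nn_one` (m < n) and `weilRank_nn_one_dual` (m > n)), `weilRankOne_vW_two` (= 16),
and PART W3: `weil_pureWeil` / `weil_pureWeil_vW` (no h-part: `2·C(2n,n)`), `weilOneSided_rankOne_vW`.  Data check (th-7): 16 / 58 / 208 at n = 2, 3, 4.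
-/

/-! ## PART W2 (th-7 g6, 2026-08-22/23): TRANSPORT OF PART G — the two purity-degree rows WITHOUT a locus.
Via PART W's change of generators `Φ` (`Φ_hbox`: `hbox(tc) ↦ vP`), Part G's one-zero corollary gives, for every field and
every `n ≥ 1`, at the middle degree `m = n` of the `(n,n)` Weil model:
* **W-PURITY(1)** `weilPurity_rankOne` / `weilRankOne_vW`: `v = c₁·Π_c(x_c + λy_c) + a·w₊ + b·w₋` (rank-ONE h-part `c₁e^{λΘ}`,
  `c₁ab ≠ 0`): `rank + 2 = 3·C(2n,n)` — NO exceptional locus (FORMULA-N PART B §L.5: S(q) nilpotent for ρ = 1; data 16 / 58 / 208);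
* **ONE-SIDED** `weilPurity_oneSided` / `weilOneSided_vW` (+ mirror `weilPurity_oneSided'`): `v = c₁Π(x_c+λy_c) + c₂Π(x_c+μy_c) + b·w₋`
  (`λ ≠ μ`, `c₁c₂b ≠ 0`): `rank + 2 = 3·C(2n,n)` — the degree the one-sided THEOREM R (`weilRank_nn_one`, `m < n`) and its
  mirror (`weilRank_nn_one_dual`, `m > n`) leave out, again with NO locus (W-PURITY a = 0 column: ρ(C−2) + C + rank N, N the
  2×2 antidiagonal ⇒ 3C − 2; data 16 / 58 / 208 at ρ = 2).
Nothing here bears on HC / HC_CM / HC_AV. -/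

namespace Summit.Ventures.HSemireg.Wedge.WeilPurity

open Module Summit.Ventures.HSemireg.Wedge.Weil
open Summit.Ventures.HSemireg.Wedge.Hankel hiding Φ isoQ Φ_ι

variable (K : Type*) [Field K] {n : ℕ}

/-- the transported coefficient `tc 0 0 = (−1)^{n·n} c₁` is non-zero when `c₁ ≠ 0`. -/
lemma tc00_ne_zero {c₁ c₂ lam mu a b : K} (h1 : c₁ ≠ 0) : tc K n c₁ c₂ lam mu a b 0 0 ≠ 0 := by
  rw [tc00]
  exact mul_ne_zero (pow_ne_zero _ (neg_ne_zero.mpr one_ne_zero)) h1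

/-- the transported coefficient `tc 0 1` (∝ `a`) is non-zero when `λ ≠ μ` and `a ≠ 0`. -/
lemma tc01_ne_zero {c₁ c₂ lam mu a b : K} (hlm : lam ≠ mu) (ha : a ≠ 0) : tc K n c₁ c₂ lam mu a b 0 1 ≠ 0 := by
  rw [tc01]
  exact mul_ne_zero ha (inv_ne_zero (mul_ne_zero (r_ne_zero K) (pow_ne_zero _ (sub_ne_zero.mpr (Ne.symm hlm)))))

/-- the transported coefficient `tc 1 0` (∝ `b`) is non-zero when `λ ≠ μ` and `b ≠ 0`. -/
lemma tc10_ne_zero {c₁ c₂ lam mu a b : K} (hlm : lam ≠ mu) (hb : b ≠ 0) : tc K n c₁ c₂ lam mu a b 1 0 ≠ 0 := by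
  rw [tc10]
  exact mul_ne_zero hb (inv_ne_zero (mul_ne_zero (r_ne_zero K) (pow_ne_zero _ (sub_ne_zero.mpr hlm))))

/-- **W-PURITY(1)** (rank-one h-part, two-sided; every field, every `n ≥ 1`): for
`v = w_{2n}(c₁λ^k) + a·Π_{c≥n}(x_c∧y_c) + b·Π_{c<n}(x_c∧y_c)` with `c₁ab ≠ 0` (the auxiliary `μ ≠ λ` only fixes the transport
basis; `vP K n c₁ 0 λ μ a b` does not depend on it), `rank(θ ↦ θ ∧ v ∣ ⋀ⁿ) + 2 = 3·C(2n,n)` — no exceptional locus. -/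
theorem weilPurity_rankOne (hn : 0 < n) {c₁ lam mu a b : K} (h1 : c₁ ≠ 0) (hlm : lam ≠ mu) (ha : a ≠ 0) (hb : b ≠ 0) :
    Module.finrank K (LinearMap.range (wedge K (n + n) n (vP K n c₁ 0 lam mu a b))) + 2 = 3 * (n + n).choose n := by
  rw [← Φ_hbox K c₁ 0 lam mu a b hlm, finrank_range_wedge_Φ]
  refine Summit.Ventures.HSemireg.WedgeBox.finrank_range_wedgeMap_hbox_one_zero K (tc K n c₁ 0 lam mu a b) hn (α₀ := 1) (β₀ := 1)
    (tc11 K c₁ 0 lam mu a b) ?_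
  intro α β hne
  by_cases hα : α = 0
  · subst hα
    by_cases hβ : β = 0
    · subst hβ; exact tc00_ne_zero K h1
    · obtain rfl : β = 1 := by omega
      exact tc01_ne_zero K hlm ha
  · obtain rfl : α = 1 := by omega
    by_cases hβ : β = 0
    · subst hβ; exact tc10_ne_zero K hlm hb
    · obtain rfl : β = 1 := by omega
      exact (hne rfl).elim

/-- **W-PURITY(1) for WeilRank's own class** `vW q a b`, `q_k = c₁λ^k` (ρ = 1), `c₁ab ≠ 0`: `rank + 2 = 3·C(2n,n)` on `⋀ⁿ`. -/
theorem weilRankOne_vW (hn : 0 < n) {c₁ lam a b : K} (h1 : c₁ ≠ 0) (ha : a ≠ 0) (hb : b ≠ 0) :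
    Module.finrank K (LinearMap.range (wedge K (n + n) n (vW K (n + n) n (fun k => c₁ * lam ^ k) a b))) + 2 =
      3 * (n + n).choose n := by
  have hlm : lam ≠ lam + 1 := by
    intro h
    have h2 : (0 : K) = 1 := add_left_cancel (a := lam) (by rw [add_zero]; exact h)
    exact zero_ne_one h2
  have hq : (fun k => c₁ * lam ^ k) = (fun k => c₁ * lam ^ k + 0 * (lam + 1) ^ k) := by
    funext k; ring
  rw [hq, vW_eq_vP]
  exact weilPurity_rankOne K hn h1 hlm (mul_ne_zero ha (r_ne_zero K (n := n))) (mul_ne_zero hb (r_ne_zero K (n := n)))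

/-- **ONE-SIDED two-exponential class at the middle degree** (`a = 0`, `c₁c₂b ≠ 0`, `λ ≠ μ`; every field, every `n ≥ 1`):
`rank(θ ↦ θ ∧ (w_{2n}(c₁λ^k + c₂μ^k) + b·Π_{c<n}(x_c∧y_c)) ∣ ⋀ⁿ) + 2 = 3·C(2n,n)` — no exceptional locus. -/
theorem weilPurity_oneSided (hn : 0 < n) {c₁ c₂ lam mu b : K} (h1 : c₁ ≠ 0) (h2 : c₂ ≠ 0) (hlm : lam ≠ mu)
    (hb : b ≠ 0) :
    Module.finrank K (LinearMap.range (wedge K (n + n) n (vP K n c₁ c₂ lam mu 0 b))) + 2 = 3 * (n + n).choose n := by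
  rw [← Φ_hbox K c₁ c₂ lam mu 0 b hlm, finrank_range_wedge_Φ]
  refine Summit.Ventures.HSemireg.WedgeBox.finrank_range_wedgeMap_hbox_one_zero K (tc K n c₁ c₂ lam mu 0 b) hn (α₀ := 0) (β₀ := 1)
    (by rw [tc01, zero_mul]) ?_
  intro α β hne
  by_cases hα : α = 0
  · subst hα
    by_cases hβ : β = 0
    · subst hβ; exact tc00_ne_zero K h1
    · obtain rfl : β = 1 := by omega
      exact (hne rfl).elim
  · obtain rfl : α = 1 := by omega
    by_cases hβ : β = 0
    · subst hβ; exact tc10_ne_zero K hlm hb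
    · obtain rfl : β = 1 := by omega
      rw [tc11]; exact h2

/-- the mirror one-sided class (`b = 0`, `c₁c₂a ≠ 0`): `rank + 2 = 3·C(2n,n)` on `⋀ⁿ`. -/
theorem weilPurity_oneSided' (hn : 0 < n) {c₁ c₂ lam mu a : K} (h1 : c₁ ≠ 0) (h2 : c₂ ≠ 0) (hlm : lam ≠ mu)
    (ha : a ≠ 0) :
    Module.finrank K (LinearMap.range (wedge K (n + n) n (vP K n c₁ c₂ lam mu a 0))) + 2 = 3 * (n + n).choose n := by
  rw [← Φ_hbox K c₁ c₂ lam mu a 0 hlm, finrank_range_wedge_Φ]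
  refine Summit.Ventures.HSemireg.WedgeBox.finrank_range_wedgeMap_hbox_one_zero K (tc K n c₁ c₂ lam mu a 0) hn (α₀ := 1) (β₀ := 0)
    (by rw [tc10, zero_mul]) ?_
  intro α β hne
  by_cases hα : α = 0
  · subst hα
    by_cases hβ : β = 0
    · subst hβ; exact tc00_ne_zero K h1
    · obtain rfl : β = 1 := by omega
      exact tc01_ne_zero K hlm ha
  · obtain rfl : α = 1 := by omega
    by_cases hβ : β = 0
    · subst hβ; exact (hne rfl).elim
    · obtain rfl : β = 1 := by omega
      rw [tc11]; exact h2

/-- ONE-SIDED, WeilRank's own class `vW q 0 b`, `q_k = c₁λ^k + c₂μ^k`, `λ ≠ μ`, `c₁c₂b ≠ 0`: `rank + 2 = 3·C(2n,n)` on `⋀ⁿ`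
(the degree `m = n` between `weilRank_nn_one` (`m < n`) and `weilRank_nn_one_dual` (`m > n`)). -/
theorem weilOneSided_vW (hn : 0 < n) {c₁ c₂ lam mu b : K} (h1 : c₁ ≠ 0) (h2 : c₂ ≠ 0) (hlm : lam ≠ mu) (hb : b ≠ 0) :
    Module.finrank K (LinearMap.range (wedge K (n + n) n (vW K (n + n) n (fun k => c₁ * lam ^ k + c₂ * mu ^ k) 0 b))) + 2 =
      3 * (n + n).choose n := by
  rw [vW_eq_vP, zero_mul]
  exact weilPurity_oneSided K hn h1 h2 hlm (mul_ne_zero hb (r_ne_zero K (n := n)))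

/-- the numbers at `n = 2`: rank `16` in all three locus-free rows (`3·6 − 2`). -/
theorem weilRankOne_vW_two {c₁ lam a b : K} (h1 : c₁ ≠ 0) (ha : a ≠ 0) (hb : b ≠ 0) :
    Module.finrank K (LinearMap.range (wedge K (2 + 2) 2 (vW K (2 + 2) 2 (fun k => c₁ * lam ^ k) a b))) = 16 := by
  have h := weilRankOne_vW K (n := 2) (by norm_num) h1 ha hb (lam := lam)
  have e : (2 + 2).choose 2 = 6 := by decide
  rw [e] at h
  omega

end Summit.Ventures.HSemireg.Wedge.WeilPurity

namespace Summit.Ventures.HSemireg.Wedge.WeilPurity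

open Module Summit.Ventures.HSemireg.Wedge.Weil
open Summit.Ventures.HSemireg.Wedge.Hankel hiding Φ isoQ Φ_ι

variable (K : Type*) [Field K] {n : ℕ}

/-- **THE PURE WEIL PAIR at the middle degree** (every field, every `n ≥ 1`, `ab ≠ 0`; `c₁ = c₂ = 0` in `vP`, so the
h-part is absent): `rank(θ ↦ θ ∧ (a·Π_{c≥n}(x_c∧y_c) + b·Π_{c<n}(x_c∧y_c)) ∣ ⋀ⁿ) = 2·C(2n,n)` — the two Weil images are
the `C(2n,n)` monomials of `V₋` resp. `V₊`, disjoint. -/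
theorem weil_pureWeil (hn : 0 < n) {lam mu a b : K} (hlm : lam ≠ mu) (ha : a ≠ 0) (hb : b ≠ 0) :
    Module.finrank K (LinearMap.range (wedge K (n + n) n (vP K n 0 0 lam mu a b))) = 2 * (n + n).choose n := by
  rw [← Φ_hbox K 0 0 lam mu a b hlm, finrank_range_wedge_Φ]
  exact Summit.Ventures.HSemireg.WedgeBox.finrank_range_wedgeMap_hbox_antidiag K (tc K n 0 0 lam mu a b) hn
    (by rw [tc00, mul_zero]) (tc11 K 0 0 lam mu a b) (tc01_ne_zero K hlm ha) (tc10_ne_zero K hlm hb)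

/-- the pure Weil pair, in WeilRank's normalisation: `vW (q = 0) a b`. -/
theorem weil_pureWeil_vW (hn : 0 < n) {a b : K} (ha : a ≠ 0) (hb : b ≠ 0) :
    Module.finrank K (LinearMap.range (wedge K (n + n) n (vW K (n + n) n (fun _ => (0 : K)) a b))) =
      2 * (n + n).choose n := by
  have hq : (fun _ : ℕ => (0 : K)) = (fun k => 0 * (0 : K) ^ k + 0 * (1 : K) ^ k) := by funext k; ring
  rw [hq, vW_eq_vP]
  exact weil_pureWeil K hn zero_ne_one (mul_ne_zero ha (r_ne_zero K (n := n))) (mul_ne_zero hb (r_ne_zero K (n := n)))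

/-- **ONE-SIDED RANK-ONE h-part at the middle degree** (`v = w_{2n}(c₁λ^k) + a·Π_{c≥n}(x_c∧y_c)`, `c₁a ≠ 0`):
`rank + 2 = 2·C(2n,n)` on `⋀ⁿ` — no exceptional locus (W-PURITY a = 0 column at ρ = 1: (C − 2) + C + 0). -/
theorem weilOneSided_rankOne_vW (hn : 0 < n) {c₁ lam a : K} (h1 : c₁ ≠ 0) (ha : a ≠ 0) :
    Module.finrank K (LinearMap.range (wedge K (n + n) n (vW K (n + n) n (fun k => c₁ * lam ^ k) a 0))) + 2 =
      2 * (n + n).choose n := by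
  have hlm : lam ≠ lam + 1 := by
    intro h
    have h2 : (0 : K) = 1 := add_left_cancel (a := lam) (by rw [add_zero]; exact h)
    exact zero_ne_one h2
  have hq : (fun k => c₁ * lam ^ k) = (fun k => c₁ * lam ^ k + 0 * (lam + 1) ^ k) := by
    funext k; ring
  rw [hq, vW_eq_vP, zero_mul, ← Φ_hbox K c₁ 0 lam (lam + 1) (a * r K n) 0 hlm, finrank_range_wedge_Φ]
  exact Summit.Ventures.HSemireg.WedgeBox.finrank_range_wedgeMap_hbox_row_zero K (tc K n c₁ 0 lam (lam + 1) (a * r K n) 0) hn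
    (by rw [tc10, zero_mul]) (tc11 K c₁ 0 lam (lam + 1) (a * r K n) 0) (tc00_ne_zero K h1)
    (tc01_ne_zero K hlm (mul_ne_zero ha (r_ne_zero K (n := n))))

end Summit.Ventures.HSemireg.Wedge.WeilPurity
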